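import Summits.ABC.IUTFork.LDHGenuinePerImageUnconditional
import Summits.ABC.IUTFork.LDHGenuinePerImageExplicit
import HarnessLib

/-!
# The fork at [IUTchIII] Corollary 3.12, L-DH level, READING (P): the typed per-image Corollary holds at EVERY point of
# the `λ`-line over EVERY number field for ALL BUT FINITELY MANY levels `l` — with an explicit level `l₀(P)`
# (abc-iut cell, crux ThetaPartII = stmt-ABC-19678; row «C:PERIMAGE-EVENTUAL»)

Record-only PROOF file (D-0012) of the abc-iut cell (WAVE-3 discharge seat abc-iut-c312-d1, gen 10). TAKES NO SIDE on [IUTchIII]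
Cor. 3.12. Every row file of the cell's C lane (`LDHGenuinePerImageFreyRows*`, `…SharpRows*`, `…ShellRows*`, `…UniformShellRows*`,
`…AllLevels`) decides the cell's READING (P) of [IUTchIII] Cor. 3.12 (`T.Cor312PerImageOf`, Dupuy–Hilado §4.12 per-image form; (Ind2) =
the tree's FULL lattice-automorphism typing) at finitely many `(λ, l)` or, per rational triple, for `l ≥ L₀ ∈ {7, 11, 13}`. This file records
the `l → ∞` STRUCTURE behind all of them, at an ARBITRARY point `P = (F₀, λ)`, `λ ∈ U_X = ℙ¹ ∖ {0, 1, ∞}`, over an ARBITRARY number field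
`F₀` (any degree `d₀ = [F₀:ℚ]`, any `d_mod`):

* `Cor22.ThetaVolumeDatumAt.sub_one_div_degree_le_ramificationIdx'` — at every genuine Θ-volume datum `T` of `(P, l)`, every place `w`
  of `K = F(E_F[l])` over a place `v ∋ l` of `F₀` has `e(w | v) ≥ ⌊(l − 1)/[F₀:ℚ]⌋`: `μ_l ⊆ K` (Weil pairing, [IUTchI] Def. 3.1 (c);
  abc-iut-s2-p4's tower lemma `InitialThetaData.sub_one_dvd_ramIdx_mul_ramificationIdx'`: `(l − 1) ∣ e(v | l)·e(w | v)`) and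
  `e(v | l) ≤ [F₀:ℚ]` (Mathlib `Ideal.ramificationIdx_le_finrank`).
* **`Cor22.ThetaVolumeDatumAt.cor312PerImageOf_of_degree_le_of_log_le`** — if `l` is a prime with `8·[F₀:ℚ] ≤ l` and
  `(2/3)·[F₀:ℚ]·log q^∀(λ) ≤ log l`, then `T.Cor312PerImageOf` for EVERY genuine Θ-volume datum `T` of `(P, l)`: abc-iut-c312-d1 gen 8's
  sharpened sufficiency `cor312PerImageOf_of_le_logDiff_logCond_ramified` with `Sₓ` = one place of `F₀` over `l`, `m = ⌊(l−1)/[F₀:ℚ]⌋ ≥ 2`,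
  whose `l`-adic gain `((l+5)/4 − d_mod)·(1 − 1/m)·(1/[F₀:ℚ])·log N(v) ≥ ((l+10)/8)·(1/2)·(1/[F₀:ℚ])·log l` beats the `q`-side
  `κ_l·log q^{∤2l}(λ) ≤ ((l+1)/24)·log q^∀(λ) ≤ ((l+1)/16)·(1/[F₀:ℚ])·log l` (`logQAvoid_anti`, `dmod_le_degree`).
* `Cor22.cor312PerImageAtDatum_of_degree_le_of_log_le` / `Cor22.cor312AtDatum_of_degree_le_of_log_le` — the same for
  `Cor312PerImageAtDatum P l` and (reading (P) ⟹ reading (U), `cor312AtDatum_of_perImage`) `Cor312AtDatum P l`.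
* **`Cor22.exists_forall_cor312PerImageAtDatum`** — `∀ P ∈ U, ∃ l₀, ∀ prime l ≥ l₀: Cor312PerImageAtDatum P l ∧ Cor312AtDatum P l`,
  with `l₀ = max(8·[F₀:ℚ], ⌈exp((2/3)·[F₀:ℚ]·log q^∀(λ))⌉)`; **`Cor22.setOf_prime_not_cor312PerImageAtDatum_finite`** — at every point the
  set of prime levels `l` at which the typed per-image Corollary FAILS at some genuine datum is FINITE.
* `Cor22.cor312PerImageAtDatum_ratPoint_of_log_le` — rational points, the better constant of abc-iut-s2-p4's `cor312PerImageOf_ratPoint_of_le`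
  (`μ_l ⊆ K` gives `e ≥ l − 1` over `l`): every prime `l ≥ 5` with `(2/9)·log q^∀(q) ≤ log l`; `Cor22.cor312PerImageAtDatum_ratPoint_of_den_le` —
  for `j(q) = N/D` in lowest terms (`D = ∏_{p∈I} p^{e_p}`): every prime `l ≥ 5` with `D² ≤ l⁹`.

HONEST SCOPE / READING. These are theorems about the tree's typed objects (reading (P); (Ind2) = `TensorPacketShell.indTwo`, the FULL
automorphism group — whose faithfulness to print's (Ind2) is an OPEN question of the cell, ref-b pass B28). They say: at a FIXED point the
typed per-image inequality can fail only at levels `l < l₀(P)`, a bound EXPONENTIAL in the height (`log l₀ ≈ (2/3)·[F₀:ℚ]·log q^∀`); the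
levels of [IUTchIV] Cor. 2.2 (`l ≈ √(height)`) lie far BELOW `l₀`, so nothing here bears on print's use of Cor. 3.12, on the Szpiro-bad
tables of the cell (decided by the row files at `l ≤ 400`), or on abc. Nothing asserts the existence of Θ-data, Cor. 3.12 in general or
in print's reading; proved-as-typed ≠ in print; no side taken. [cite: Mochizuki2012, IUTchI Def. 3.1 (c) p. 62; IUTchIII Cor. 3.12
p. 173–174, proof Step (x) p. 181; IUTchIV Thm. 1.10 Step (ii) p. 24, Step (v) p. 27–29; Cor. 2.2 (ii) proof p. 46]
[cite: SilvermanAEC2009, Cor. III.8.1.1] [cite: Washington1997, Lemma 1.4 and Prop. 2.1] [cite: NeukirchANT1999, Ch. II Prop. (6.8)]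
[cite: DupuyHilado2025, §4.9, §4.12] [claim: Mochizuki2012, status: disputed] for every IUT quotation. PROOF-ONLY: no definitions, no new `Prop`.
-/

noncomputable section

open NumberField IsDedekindDomain Ideal Module

namespace Literature.IUT.LogVolume.Cor22

open Literature.NumberTheory.DiophantineGeometry.GenEll Summit.ABC.IUTFork Literature.IUT.HodgeTheaters
open Literature.NumberTheory.DiophantineGeometry.UniformABCConjecture

/-! ## 1. `⌊(l − 1)/[F₀:ℚ]⌋ ≤ e(w | v)` over every place `v ∋ l` of `F₀`, at every genuine datum -/

namespace ThetaVolumeDatumAt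

variable {P : NFPoint} {l : ℕ} (T : ThetaVolumeDatumAt P l)

/-- **`⌊(l − 1)/[F₀:ℚ]⌋ ≤ e(w | v)`** for every finite place `v` of `F₀ = F_tpd` containing `l` and every prime `w` of the datum's
`K = F(E_F[l])` over `v`: `(l − 1) ∣ e(v | l)·e(w | v)` (`μ_l ⊆ K`, abc-iut-s2-p4's `InitialThetaData.sub_one_dvd_ramIdx_mul_ramificationIdx'`),
`e(w | v) ≠ 0`, and `e(v | l) ≤ [F₀:ℚ]` (Mathlib `Ideal.ramificationIdx_le_finrank`). [cite: Mochizuki2012, IUTchI Def. 3.1 (c) p. 62]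
[cite: Washington1997, Lemma 1.4 and Prop. 2.1] [cite: NeukirchANT1999, Ch. II Prop. (6.8)] [claim: Mochizuki2012, status: disputed] -/
theorem sub_one_div_degree_le_ramificationIdx' (v : HeightOneSpectrum (𝓞 P.F)) (hv : ((l : ℕ) : 𝓞 P.F) ∈ v.asIdeal) :
    letI := T.instFieldF; letI := T.instNumberFieldF; letI := T.instAlgebraF; letI := T.instFieldK
    letI := T.instNumberFieldK; letI := T.instAlgebraK
    letI : Algebra P.F T.K := ((algebraMap T.F T.K).comp (algebraMap P.F T.F)).toAlgebra
    ∀ w ∈ IsDedekindDomain.primesOverFinset v.asIdeal (𝓞 T.K), (l - 1) / P.degree ≤ ramificationIdx' v.asIdeal w := by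
  letI := T.instFieldF; letI := T.instNumberFieldF; letI := T.instAlgebraF; letI := T.instFieldK
  letI := T.instNumberFieldK; letI := T.instAlgebraK; letI := T.instFieldFbar; letI := T.instAlgebraFbar
  letI := T.instAlgebraKFbar; letI := T.instIsElliptic
  letI : Algebra P.F T.K := ((algebraMap T.F T.K).comp (algebraMap P.F T.F)).toAlgebra
  intro w hw
  haveI : v.asIdeal.IsMaximal := v.isMaximal
  have hw' := (IsDedekindDomain.mem_primesOverFinset_iff v.ne_bot (𝓞 T.K)).mp hw
  haveI : w.IsPrime := hw'.1
  haveI : w.LiesOver v.asIdeal := hw'.2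
  have hwbot : w ≠ ⊥ := Ideal.ne_bot_of_liesOver_of_ne_bot v.ne_bot w
  -- `(l − 1) ∣ e(v | l)·e(w | v)`
  have hdvd : (l - 1) ∣ ramIdx P.F v * Ideal.ramificationIdx' v.asIdeal w :=
    T.D.sub_one_dvd_ramIdx_mul_ramificationIdx' v hv hw
  -- `e(v | l)·e(w | v) = e(w | l) > 0`
  set W : HeightOneSpectrum (𝓞 T.K) := ⟨w, hw'.1, hwbot⟩ with hW
  have hunder : W.under (𝓞 P.F) = v :=
    HeightOneSpectrum.ext (Ideal.LiesOver.over (P := w) (p := v.asIdeal)).symm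
  have hpos : 0 < W.asIdeal.ramificationIdx ℤ := Ideal.ramificationIdx_pos _ _
  rw [ThetaData.absRamificationIdx_eq_ramIdx_mul (F := P.F) W, hunder] at hpos
  have hle : l - 1 ≤ ramIdx P.F v * Ideal.ramificationIdx' v.asIdeal w := Nat.le_of_dvd hpos hdvd
  -- `e(v | l) ≤ [F₀ : ℚ]`
  have hram : ramIdx P.F v ≤ P.degree := by
    haveI : (v.asIdeal.under ℤ).IsMaximal := Ideal.IsMaximal.under ℤ v.asIdeal
    have h0 : v.asIdeal.under ℤ ≠ ⊥ := mt Ideal.eq_bot_of_comap_eq_bot v.ne_bot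
    have h1 : v.asIdeal.ramificationIdx ℤ ≤ Module.finrank ℚ P.F := by
      rw [← Ideal.ramificationIdx'_eq_ramificationIdx (v.asIdeal.under ℤ) v.asIdeal h0]
      exact Ideal.ramificationIdx_le_finrank (𝓞 P.F) ℚ P.F v.asIdeal (p := v.asIdeal.under ℤ)
    rw [← ramIdx_eq] at h1
    exact h1
  have hle' : l - 1 ≤ P.degree * Ideal.ramificationIdx' v.asIdeal w :=
    hle.trans (Nat.mul_le_mul_right _ hram)
  exact Nat.div_le_of_le_mul hle'

/-! ## 2. The explicit level: `8·[F₀:ℚ] ≤ l` and `(2/3)·[F₀:ℚ]·log q^∀(λ) ≤ log l` suffice -/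

/-- **THE TYPED PER-IMAGE COROLLARY AT EVERY LARGE LEVEL, ANY POINT, ANY NUMBER FIELD**: for `λ ∈ U_X` presented over `F₀`, a prime `l`
with `8·[F₀:ℚ] ≤ l` and `(2/3)·[F₀:ℚ]·log q^∀(λ) ≤ log l`, and EVERY genuine Θ-volume datum `T` of `(P, l)`: `T.Cor312PerImageOf`.
Proof: `cor312PerImageOf_of_le_logDiff_logCond_ramified` (gen 8) with `Sₓ = {v}`, `v` a place of `F₀` over `l` (`placesOver_nonempty`),
`m = ⌊(l−1)/[F₀:ℚ]⌋ ≥ 2` (§1); then `κ_l·log q^{∤2l} ≤ ((l+1)/24)·log q^∀ ≤ ((l+1)/16)·log l/[F₀:ℚ]` while the Θ-side is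
`≥ ((l+5)/4 − d_mod)·(1 − 1/m)·log N(v)/[F₀:ℚ] ≥ ((l+10)/8)·(1/2)·log l/[F₀:ℚ]` (`d_mod ≤ [F₀:ℚ] ≤ l/8`, `N(v) = l^f ≥ l`, log-diff and
log-cond `≥ 0`). [cite: Mochizuki2012, IUTchIII Cor. 3.12 p. 173–174; IUTchIV Thm. 1.10 Step (ii) p. 24, Step (v) p. 27–29]
[cite: Washington1997, Lemma 1.4 and Prop. 2.1] [claim: Mochizuki2012, status: disputed] -/
theorem cor312PerImageOf_of_degree_le_of_log_le (hU : P.InU) (hl : l.Prime) (h8 : 8 * P.degree ≤ l)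
    (hlog : (2 / 3 : ℝ) * P.degree * logQForall P ≤ Real.log l) : T.Cor312PerImageOf := by
  classical
  letI := T.instFieldF; letI := T.instNumberFieldF; letI := T.instAlgebraF; letI := T.instFieldK
  letI := T.instNumberFieldK; letI := T.instAlgebraK
  letI : Algebra P.F T.K := ((algebraMap T.F T.K).comp (algebraMap P.F T.F)).toAlgebra
  haveI : Fact l.Prime := ⟨hl⟩
  have hd₀ : 1 ≤ P.degree := P.degree_pos
  have hl8 : 8 ≤ l := le_trans (by omega) h8
  -- a place `v` of `F₀` over `l`
  obtain ⟨v, hvmem⟩ := placesOver_nonempty P.F l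
  have hv : ((l : ℕ) : 𝓞 P.F) ∈ v.asIdeal :=
    (natCast_mem_asIdeal_iff_residueChar_eq v hl).mpr ((mem_placesOver_iff_residueChar v).mp hvmem)
  -- it is not a bad place "away from `2l`"
  have hnot : v ∉ badPlacesAvoid P {2, l} := by
    intro hbad
    unfold badPlacesAvoid at hbad
    exact (Finset.mem_filter.1 hbad).2 l (Finset.mem_insert_of_mem (Finset.mem_singleton_self l)) hv
  -- `m = ⌊(l−1)/[F₀:ℚ]⌋ ≥ 2`
  set m : ℕ := (l - 1) / P.degree with hm
  have hm2 : 2 ≤ m := by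
    rw [hm]
    exact (Nat.le_div_iff_mul_le P.degree_pos).mpr (by omega)
  have hram : ∀ v' ∈ ({v} : Finset (HeightOneSpectrum (𝓞 P.F))),
      ∀ w ∈ IsDedekindDomain.primesOverFinset v'.asIdeal (𝓞 T.K), m ≤ ramificationIdx' v'.asIdeal w := by
    intro v' hv' w hw
    rw [Finset.mem_singleton] at hv'
    rw [hv'] at hw ⊢
    exact T.sub_one_div_degree_le_ramificationIdx' v hv w hw
  -- `d_mod ≤ [F₀:ℚ] ≤ l/8 ≤ (l+5)/4`
  have hdmod : (dmod P : ℝ) ≤ P.degree := by exact_mod_cast dmod_le_degree P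
  have hd₀R : (1 : ℝ) ≤ P.degree := by exact_mod_cast hd₀
  have h8R : 8 * (P.degree : ℝ) ≤ l := by exact_mod_cast h8
  have hlR : (8 : ℝ) ≤ l := by exact_mod_cast hl8
  have hd : (dmod P : ℝ) ≤ ((l : ℝ) + 5) / 4 := by linarith
  refine T.cor312PerImageOf_of_le_logDiff_logCond_ramified hU hl.pos hd {v}
    (Finset.disjoint_singleton_right.2 hnot) (by omega : 0 < m) hram ?_
  -- the numbers
  have harch : ThetaVolumeInput.archLogTheta l = ((l : ℝ) + 5) / 4 * Real.log Real.pi := rfl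
  rw [harch, Finset.sum_singleton]
  set X : ℝ := logQAvoid P {2, l} with hX
  set X₀ : ℝ := logQForall P with hX₀
  set Y : ℝ := logCondAvoid P {2, l} with hY
  set L : ℝ := Real.log l with hLdef
  set δ : ℝ := (P.degree : ℝ)⁻¹ with hδ
  have hX0 : 0 ≤ X := logQAvoid_nonneg P _
  have hXX₀ : X ≤ X₀ := by
    rw [hX, hX₀]
    exact logQAvoid_anti P (Finset.empty_subset _)
  have hY0 : 0 ≤ Y := logCondAvoid_nonneg P _
  have hD0 : 0 ≤ P.logDiff := P.logDiff_nonneg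
  have hL0 : 0 ≤ L := Real.log_nonneg (by linarith)
  have hpi : 0 < Real.log Real.pi := Real.log_pos (by linarith [Real.pi_gt_three])
  have hδpos : 0 < δ := by rw [hδ]; positivity
  have hδd : δ * (P.degree : ℝ) = 1 := by
    rw [hδ]; exact inv_mul_cancel₀ (by positivity)
  -- `log N(v) ≥ log l`
  have hN : L ≤ Real.log (absNorm v.asIdeal : ℝ) := by
    rw [hLdef]
    have hf : 0 < v.asIdeal.inertiaDeg ℤ := by
      haveI : v.asIdeal.IsMaximal := v.isMaximal
      exact Ideal.inertiaDeg_pos _ _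
    have hpow : ((absNorm v.asIdeal : ℕ) : ℝ) = (l : ℝ) ^ v.asIdeal.inertiaDeg ℤ := by
      rw [absNorm_eq_pow_inertiaDeg P.F l v hv]; push_cast; rfl
    rw [hpow]
    refine Real.log_le_log (by positivity) ?_
    calc (l : ℝ) = (l : ℝ) ^ 1 := (pow_one _).symm
      _ ≤ (l : ℝ) ^ v.asIdeal.inertiaDeg ℤ := pow_le_pow_right₀ (by linarith) hf
  -- `1 − 1/m ≥ 1/2`
  have hm' : (1 / 2 : ℝ) ≤ 1 - (m : ℝ)⁻¹ := by
    have h2 : (2 : ℝ) ≤ m := by exact_mod_cast hm2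
    have : (m : ℝ)⁻¹ ≤ 2⁻¹ := inv_anti₀ (by norm_num) h2
    linarith
  -- `X₀ ≤ (3/2)·δ·L`
  have hX₀L : X₀ ≤ 3 / 2 * (δ * L) := by
    have h1 : X₀ = 3 / 2 * δ * ((2 / 3 : ℝ) * P.degree * X₀) := by
      have : 3 / 2 * δ * ((2 / 3 : ℝ) * P.degree * X₀) = (δ * (P.degree : ℝ)) * X₀ := by ring
      rw [this, hδd, one_mul]
    rw [h1]
    have := mul_le_mul_of_nonneg_left hlog (by positivity : (0 : ℝ) ≤ 3 / 2 * δ)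
    linarith
  -- the Θ-side gain
  have hc : ((l : ℝ) + 10) / 8 ≤ ((l : ℝ) + 5) / 4 - dmod P := by linarith
  have hgain : ((l : ℝ) + 10) / 8 * ((1 / 2 : ℝ) * (δ * L)) ≤
      (((l : ℝ) + 5) / 4 - dmod P) * ((1 - (m : ℝ)⁻¹) * (δ * Real.log (absNorm v.asIdeal : ℝ))) := by
    refine mul_le_mul hc ?_ (by positivity) (by linarith)
    exact mul_le_mul hm' (mul_le_mul_of_nonneg_left hN hδpos.le) (by positivity) (by linarith)
  -- the `q`-side
  have hκ : (((l : ℝ) + 1) / 24 - 1 / (2 * l)) * X ≤ ((l : ℝ) + 1) / 24 * X₀ := by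
    have h1 : 0 ≤ 1 / (2 * (l : ℝ)) * X := by positivity
    have h2 : ((l : ℝ) + 1) / 24 * X ≤ ((l : ℝ) + 1) / 24 * X₀ := mul_le_mul_of_nonneg_left hXX₀ (by positivity)
    nlinarith
  have hq : ((l : ℝ) + 1) / 24 * X₀ ≤ ((l : ℝ) + 1) / 16 * (δ * L) := by
    have := mul_le_mul_of_nonneg_left hX₀L (by positivity : (0 : ℝ) ≤ ((l : ℝ) + 1) / 24)
    linarith
  -- nonnegativity of the dropped terms
  have hrest : 0 ≤ (((l : ℝ) + 5) / 4 - dmod P) * (P.logDiff + (1 - 1 / (l : ℝ)) * Y) := by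
    have h1 : 0 ≤ 1 - 1 / (l : ℝ) := by
      rw [sub_nonneg, div_le_one (by linarith)]; linarith
    exact mul_nonneg (by linarith) (add_nonneg hD0 (mul_nonneg h1 hY0))
  have hδL : 0 ≤ δ * L := mul_nonneg hδpos.le hL0
  calc (((l : ℝ) + 1) / 24 - 1 / (2 * l)) * X
      ≤ ((l : ℝ) + 1) / 16 * (δ * L) := hκ.trans hq
    _ ≤ ((l : ℝ) + 10) / 8 * ((1 / 2 : ℝ) * (δ * L)) := by nlinarith
    _ ≤ (((l : ℝ) + 5) / 4 - dmod P) * ((1 - (m : ℝ)⁻¹) * (δ * Real.log (absNorm v.asIdeal : ℝ))) := hgain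
    _ ≤ (((l : ℝ) + 5) / 4 - dmod P) * (P.logDiff + (1 - 1 / (l : ℝ)) * Y
          + (1 - (m : ℝ)⁻¹) * (δ * Real.log (absNorm v.asIdeal : ℝ)))
        + ((l : ℝ) + 5) / 4 * Real.log Real.pi := by
      rw [mul_add]
      nlinarith

end ThetaVolumeDatumAt

variable {P : NFPoint} {l : ℕ}

/-- **`Cor312PerImageAtDatum P l` at every large level** (`λ ∈ U_X`; prime `l` with `8·[F₀:ℚ] ≤ l` and
`(2/3)·[F₀:ℚ]·log q^∀(λ) ≤ log l`): [IUTchIII] Cor. 3.12 in reading (P), AS TYPED, at EVERY genuine Θ-volume datum of `(P, l)`.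
[cite: Mochizuki2012, IUTchIII Cor. 3.12 p. 173–174] [claim: Mochizuki2012, status: disputed] -/
theorem cor312PerImageAtDatum_of_degree_le_of_log_le (hU : P.InU) (hl : l.Prime) (h8 : 8 * P.degree ≤ l)
    (hlog : (2 / 3 : ℝ) * P.degree * logQForall P ≤ Real.log l) : Cor312PerImageAtDatum P l :=
  fun T => T.cor312PerImageOf_of_degree_le_of_log_le hU hl h8 hlog

/-- **`Cor312AtDatum P l` at every large level** (reading (P) ⟹ reading (U), `cor312AtDatum_of_perImage`): under the same two
inequalities on `l`, "`−|log(Θ)| ≥ −|log(q)|`" holds for the DEFINED numbers of every genuine Θ-volume datum of `(P, l)`.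
[cite: Mochizuki2012, IUTchIII Cor. 3.12 p. 174] [claim: Mochizuki2012, status: disputed] -/
theorem cor312AtDatum_of_degree_le_of_log_le (hU : P.InU) (hl : l.Prime) (h8 : 8 * P.degree ≤ l)
    (hlog : (2 / 3 : ℝ) * P.degree * logQForall P ≤ Real.log l) : Cor312AtDatum P l :=
  cor312AtDatum_of_perImage (cor312PerImageAtDatum_of_degree_le_of_log_le hU hl h8 hlog)

/-! ## 3. All but finitely many levels -/

/-- **EVENTUAL FORM**: for every `λ ∈ U_X` over any number field `F₀` there is an (explicit) `l₀ = max(8·[F₀:ℚ], ⌈exp((2/3)·[F₀:ℚ]·log q^∀(λ))⌉)`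
such that for EVERY prime `l ≥ l₀` the typed Corollary holds at every genuine Θ-volume datum of `(P, l)` in BOTH readings (P) and (U).
[cite: Mochizuki2012, IUTchIII Cor. 3.12 p. 173–174] [claim: Mochizuki2012, status: disputed] -/
theorem exists_forall_cor312PerImageAtDatum (hU : P.InU) :
    ∃ l₀ : ℕ, ∀ l : ℕ, l.Prime → l₀ ≤ l → Cor312PerImageAtDatum P l ∧ Cor312AtDatum P l := by
  refine ⟨max (8 * P.degree) ⌈Real.exp ((2 / 3 : ℝ) * P.degree * logQForall P)⌉₊, fun l hl hle => ?_⟩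
  have h8 : 8 * P.degree ≤ l := le_trans (le_max_left _ _) hle
  have hceil : ⌈Real.exp ((2 / 3 : ℝ) * P.degree * logQForall P)⌉₊ ≤ l := le_trans (le_max_right _ _) hle
  have hlog : (2 / 3 : ℝ) * P.degree * logQForall P ≤ Real.log l := by
    have h1 : Real.exp ((2 / 3 : ℝ) * P.degree * logQForall P) ≤ (l : ℝ) :=
      le_trans (Nat.le_ceil _) (by exact_mod_cast hceil)
    have h2 := Real.log_le_log (Real.exp_pos _) h1
    rwa [Real.log_exp] at h2
  exact ⟨cor312PerImageAtDatum_of_degree_le_of_log_le hU hl h8 hlog,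
    cor312AtDatum_of_degree_le_of_log_le hU hl h8 hlog⟩

/-- **FINITENESS OF THE EXCEPTIONAL LEVELS**: at every `λ ∈ U_X` (any number field), the set of PRIME levels `l` at which the typed
per-image Corollary fails at some genuine Θ-volume datum of `(P, l)` is FINITE (contained in `{l < l₀(P)}`). A statement about the
tree's typed objects: nothing is said about WHICH small levels are exceptional (the cell's row files decide the tabulated ones), about
print's reading, or about abc. [cite: Mochizuki2012, IUTchIII Cor. 3.12 p. 173–174] [claim: Mochizuki2012, status: disputed] -/
theorem setOf_prime_not_cor312PerImageAtDatum_finite (hU : P.InU) :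
    {l : ℕ | l.Prime ∧ ¬ Cor312PerImageAtDatum P l}.Finite := by
  obtain ⟨l₀, h⟩ := exists_forall_cor312PerImageAtDatum hU
  refine (Set.finite_Iio l₀).subset fun l hl => ?_
  rcases hl with ⟨hp, hnot⟩
  by_contra hge
  exact hnot (h l hp (not_lt.mp hge)).1

/-- The (U)-reading twin: the set of prime levels `l` with `¬ Cor312AtDatum P l` is finite. [cite: Mochizuki2012, IUTchIII Cor. 3.12 p. 174]
[claim: Mochizuki2012, status: disputed] -/
theorem setOf_prime_not_cor312AtDatum_finite (hU : P.InU) :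
    {l : ℕ | l.Prime ∧ ¬ Cor312AtDatum P l}.Finite := by
  obtain ⟨l₀, h⟩ := exists_forall_cor312PerImageAtDatum hU
  refine (Set.finite_Iio l₀).subset fun l hl => ?_
  rcases hl with ⟨hp, hnot⟩
  by_contra hge
  exact hnot (h l hp (not_lt.mp hge)).2

/-! ## 4. Rational points: every prime `l ≥ 5` with `(2/9)·log q^∀(q) ≤ log l` -/

/-- **RATIONAL POINTS** (`q ∈ ℚ ∖ {0,1}`): every prime `l ≥ 5` with `(2/9)·log q^∀(q) ≤ log l` gives `Cor312PerImageAtDatum (ratPoint q) l`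
— abc-iut-s2-p4's `cor312PerImageOf_ratPoint_of_le` (over `ℚ`, `μ_l ⊆ K` forces `e ≥ l − 1` over `l`, gain `(1 − 1/(l−1))·log l ≥ (3/4)·log l`)
with `κ_l·log q^{∤2l} ≤ ((l+1)/24)·log q^∀ ≤ ((l+1)/24)·(9/2)·log l = ((l+1)/4)·(3/4)·log l`. [cite: Mochizuki2012, IUTchIII Cor. 3.12 p. 173–174]
[cite: Washington1997, Lemma 1.4 and Prop. 2.1] [claim: Mochizuki2012, status: disputed] -/
theorem cor312PerImageAtDatum_ratPoint_of_log_le {q : ℚ} (hq0 : q ≠ 0) (hq1 : q ≠ 1) (hl : l.Prime) (h5 : 5 ≤ l)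
    (hlog : (2 / 9 : ℝ) * logQForall (ratPoint q) ≤ Real.log l) : Cor312PerImageAtDatum (ratPoint q) l := by
  intro T
  refine cor312PerImageOf_ratPoint_of_le hq0 hq1 hl h5 ?_ T
  set X : ℝ := logQAvoid (ratPoint q) {2, l} with hX
  set X₀ : ℝ := logQForall (ratPoint q) with hX₀
  set Y : ℝ := logCondAvoid (ratPoint q) {2, l} with hY
  set L : ℝ := Real.log l with hLdef
  have hlR : (5 : ℝ) ≤ l := by exact_mod_cast h5
  have hX0 : 0 ≤ X := logQAvoid_nonneg _ _
  have hXX₀ : X ≤ X₀ := by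
    rw [hX, hX₀]
    exact logQAvoid_anti _ (Finset.empty_subset _)
  have hY0 : 0 ≤ Y := logCondAvoid_nonneg _ _
  have hL0 : 0 ≤ L := Real.log_nonneg (by linarith)
  have hpi : 0 < Real.log Real.pi := Real.log_pos (by linarith [Real.pi_gt_three])
  have hcast : ((l - 1 : ℕ) : ℝ) = (l : ℝ) - 1 := by
    rw [Nat.cast_sub (by omega : 1 ≤ l), Nat.cast_one]
  rw [hcast]
  -- `1 − 1/(l−1) ≥ 3/4`
  have h34 : (3 / 4 : ℝ) ≤ 1 - ((l : ℝ) - 1)⁻¹ := by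
    have : ((l : ℝ) - 1)⁻¹ ≤ 4⁻¹ := inv_anti₀ (by norm_num) (by linarith)
    linarith
  have h1l : 0 ≤ 1 - 1 / (l : ℝ) := by
    rw [sub_nonneg, div_le_one (by linarith)]; linarith
  have hκ : (((l : ℝ) + 1) / 24 - 1 / (2 * l)) * X ≤ ((l : ℝ) + 1) / 24 * X₀ := by
    have h1 : 0 ≤ 1 / (2 * (l : ℝ)) * X := by positivity
    have h2 : ((l : ℝ) + 1) / 24 * X ≤ ((l : ℝ) + 1) / 24 * X₀ := mul_le_mul_of_nonneg_left hXX₀ (by positivity)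
    nlinarith
  have hX₀L : X₀ ≤ 9 / 2 * L := by linarith
  have hmid : ((l : ℝ) + 1) / 24 * X₀ ≤ ((l : ℝ) + 1) / 4 * ((3 / 4 : ℝ) * L) := by
    have := mul_le_mul_of_nonneg_left hX₀L (by positivity : (0 : ℝ) ≤ ((l : ℝ) + 1) / 24)
    linarith
  have hgain : ((l : ℝ) + 1) / 4 * ((3 / 4 : ℝ) * L) ≤ (((l : ℝ) + 5) / 4 - 1) * ((1 - ((l : ℝ) - 1)⁻¹) * L) := by
    have h1 : ((l : ℝ) + 1) / 4 = ((l : ℝ) + 5) / 4 - 1 := by ring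
    rw [h1]
    exact mul_le_mul_of_nonneg_left (mul_le_mul_of_nonneg_right h34 hL0) (by linarith)
  calc (((l : ℝ) + 1) / 24 - 1 / (2 * l)) * X
      ≤ (((l : ℝ) + 5) / 4 - 1) * ((1 - ((l : ℝ) - 1)⁻¹) * L) := (hκ.trans hmid).trans hgain
    _ ≤ (((l : ℝ) + 5) / 4 - 1) * ((1 - 1 / (l : ℝ)) * Y + (1 - ((l : ℝ) - 1)⁻¹) * L)
        + ((l : ℝ) + 5) / 4 * Real.log Real.pi := by
      have h1 : 0 ≤ (((l : ℝ) + 5) / 4 - 1) * ((1 - 1 / (l : ℝ)) * Y) := mul_nonneg (by linarith) (mul_nonneg h1l hY0)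
      have h2 : 0 ≤ ((l : ℝ) + 5) / 4 * Real.log Real.pi := by positivity
      rw [mul_add]
      linarith

/-- The (U)-reading twin at a rational point. [cite: Mochizuki2012, IUTchIII Cor. 3.12 p. 174] [claim: Mochizuki2012, status: disputed] -/
theorem cor312AtDatum_ratPoint_of_log_le {q : ℚ} (hq0 : q ≠ 0) (hq1 : q ≠ 1) (hl : l.Prime) (h5 : 5 ≤ l)
    (hlog : (2 / 9 : ℝ) * logQForall (ratPoint q) ≤ Real.log l) : Cor312AtDatum (ratPoint q) l :=
  cor312AtDatum_of_perImage (cor312PerImageAtDatum_ratPoint_of_log_le hq0 hq1 hl h5 hlog)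

/-- **RATIONAL POINTS, IN TERMS OF THE DENOMINATOR OF `j`**: for `q ∈ ℚ ∖ {0,1}` with `j(q) = N/D`, `D = ∏_{p∈I} p^{e_p}` (`p ∤ N` for
`p ∈ I`): `log q^∀(q) = log D` (`logQAvoid_ratPoint_eq_sum` with `S = ∅`), so EVERY prime `l ≥ 5` with `D² ≤ l⁹` gives
`Cor312PerImageAtDatum (ratPoint q) l` (and `Cor312AtDatum`). [cite: Mochizuki2012, IUTchIII Cor. 3.12 p. 173–174; IUTchIV Thm. 1.10 p. 23]
[claim: Mochizuki2012, status: disputed] -/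
theorem cor312PerImageAtDatum_ratPoint_of_den_le {q : ℚ} {N D : ℕ} {I : Finset ℕ} {e : ℕ → ℕ} (hq0 : q ≠ 0) (hq1 : q ≠ 1)
    (hI : ∀ p ∈ I, p.Prime) (he : ∀ p ∈ I, e p ≠ 0) (hD : D = ∏ p ∈ I, p ^ e p)
    (hj : jInv q = (N : ℚ) / (D : ℚ)) (hN : N ≠ 0) (hcop : ∀ p ∈ I, ¬ p ∣ N)
    (hl : l.Prime) (h5 : 5 ≤ l) (hDl : D ^ 2 ≤ l ^ 9) :
    Cor312PerImageAtDatum (ratPoint q) l ∧ Cor312AtDatum (ratPoint q) l := by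
  classical
  have hsum : logQForall (ratPoint q) = Real.log D := by
    unfold logQForall
    rw [logQAvoid_ratPoint_eq_sum hI he hD hj hN ∅ (fun p hp _ => hcop p hp)]
    have hfilter : I.filter (fun p => ∀ s ∈ (∅ : Finset ℕ), ¬ p ∣ s) = I :=
      Finset.filter_true_of_mem fun p _ s hs => absurd hs (Finset.notMem_empty s)
    rw [hfilter, hD, Nat.cast_prod, Real.log_prod]
    · exact Finset.sum_congr rfl fun p _ => by rw [Nat.cast_pow, Real.log_pow]
    · intro p hp
      exact_mod_cast (pow_pos (hI p hp).pos _).ne'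
  have hDpos : 0 < D := by
    rw [hD]; exact Finset.prod_pos fun p hp => pow_pos (hI p hp).pos _
  have hlog : (2 / 9 : ℝ) * logQForall (ratPoint q) ≤ Real.log l := by
    rw [hsum]
    have h1 : ((D ^ 2 : ℕ) : ℝ) ≤ ((l ^ 9 : ℕ) : ℝ) := by exact_mod_cast hDl
    push_cast at h1
    have h2 := Real.log_le_log (by positivity) h1
    rw [Real.log_pow, Real.log_pow] at h2
    push_cast at h2
    linarith
  exact ⟨cor312PerImageAtDatum_ratPoint_of_log_le hq0 hq1 hl h5 hlog,
    cor312AtDatum_ratPoint_of_log_le hq0 hq1 hl h5 hlog⟩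

end Literature.IUT.LogVolume.Cor22

end
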